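import Literature.RingTheory.FormalGroups.LazardLogLaw
import HarnessLib

/-!
# Lazard's theorem: the Lazard ring is the polynomial ring `ℤ[T₀, T₁, …]`, one generator in each weight
# ([Lazard1955] Théorème II; [Hazewinkel1978] Thm. 5.3.8 / §5.5)

Topic `Literature/RingTheory/FormalGroups`; namespace `Literature.RingTheory.FormalGroups`.  Plumbing definitions
(`LowDeg`, `LazardRing.equivMvPolynomial`, `LazardRing.univLawPoly`) and fully proved theorems; no named fact, no instance,
no notation, no `sorry`.

The ring map `θ : ℤ[T] → L`, `T_k ↦ t_{k+2}` is surjective (★ `LazardRing.genHom_surjective`, file `LazardRingGenerators`),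
and its composite with the classifying map `Φ : L → ℤ[b]` of the universal strictly-isomorphic-to-additive law sends `T_k` to a
polynomial with no constant term and linear part `−ν(k+2)·b_k` (★ `LazardLogLaw`).  §1 proves that such a «unitriangular up
to nonzero integers» endomorphism of `ℤ[T]` is INJECTIVE (`injective_of_linearPart`: look at the monomials of lowest degree —
the `(T)`-adic filtration), so `θ` is bijective: **LAZARD'S THEOREM** `L ≃+* ℤ[T₀, T₁, …]` (`LazardRing.equivMvPolynomial`).
§3 transports the universal law to `ℤ[T]` (`LazardRing.univLawPoly`) and restates universality there: every commutative
one-dimensional formal group law over any commutative ring is the base change of `univLawPoly` along a (unique) ring map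
(`LazardRing.exists_map_univLawPoly_eq`, `LazardRing.map_univLawPoly_ext`).

## References
* [Lazard1955] M. Lazard, *Sur les groupes de Lie formels à un paramètre*, Bull. SMF 83 (1955), Théorème II (p. 254), §III.
* [Hazewinkel1978] M. Hazewinkel, *Formal Groups and Applications* (1978), §5.3–§5.5.
-/

noncomputable section

namespace Literature.RingTheory.FormalGroups

open Finset
open _root_.MvPowerSeries (coeff)

universe u

/-! ## §1 Polynomials whose monomials all have degree `≥ N`, and the injectivity criterion -/

/-- `LowDeg N f`: every monomial of `f ∈ ℤ[T]` has total degree at least `N` (`f ∈ (T)^N`). [cite: Lazard1955, §III] -/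
def LowDeg (N : ℕ) (f : MvPolynomial ℕ ℤ) : Prop := ∀ α, MvPolynomial.coeff α f ≠ 0 → N ≤ Finsupp.degree α

namespace LowDeg

variable {N M : ℕ} {f g : MvPolynomial ℕ ℤ}

/-- Weakening. [cite: Lazard1955, §III] -/
theorem mono (h : LowDeg N f) (hMN : M ≤ N) : LowDeg M f := fun α hα => le_trans hMN (h α hα)

/-- `0` has all degrees `≥ N`. [cite: Lazard1955, §III] -/
theorem zero (N : ℕ) : LowDeg N 0 := fun α hα => (hα (MvPolynomial.coeff_zero α)).elim

/-- Every polynomial has degrees `≥ 0`. [cite: Lazard1955, §III] -/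
theorem zero_le (f : MvPolynomial ℕ ℤ) : LowDeg 0 f := fun _ _ => Nat.zero_le _

/-- Sums. [cite: Lazard1955, §III] -/
theorem add (hf : LowDeg N f) (hg : LowDeg N g) : LowDeg N (f + g) := fun α hα => by
  rw [MvPolynomial.coeff_add] at hα
  by_cases h : MvPolynomial.coeff α f = 0
  · rw [h, zero_add] at hα; exact hg α hα
  · exact hf α h

/-- Negatives. [cite: Lazard1955, §III] -/
theorem neg (hf : LowDeg N f) : LowDeg N (-f) := fun α hα => hf α (by rwa [MvPolynomial.coeff_neg, neg_ne_zero] at hα)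

/-- Differences. [cite: Lazard1955, §III] -/
theorem sub (hf : LowDeg N f) (hg : LowDeg N g) : LowDeg N (f - g) := by rw [sub_eq_add_neg]; exact hf.add hg.neg

/-- Finite sums. [cite: Lazard1955, §III] -/
theorem sum {ι : Type*} (S : Finset ι) {f : ι → MvPolynomial ℕ ℤ} (h : ∀ i ∈ S, LowDeg N (f i)) :
    LowDeg N (∑ i ∈ S, f i) := by
  classical
  induction S using Finset.induction_on with
  | empty => rw [sum_empty]; exact zero N
  | insert a S ha ih =>
    rw [sum_insert ha]
    exact (h a (mem_insert_self a S)).add (ih fun i hi => h i (mem_insert_of_mem hi))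

/-- **Products: degrees add.** [cite: Lazard1955, §III] -/
theorem mul (hf : LowDeg N f) (hg : LowDeg M g) : LowDeg (N + M) (f * g) := fun α hα => by
  classical
  rw [MvPolynomial.coeff_mul] at hα
  obtain ⟨x, hx, hne⟩ := exists_ne_zero_of_sum_ne_zero hα
  have h1 : MvPolynomial.coeff x.1 f ≠ 0 := fun h => hne (by rw [h, zero_mul])
  have h2 : MvPolynomial.coeff x.2 g ≠ 0 := fun h => hne (by rw [h, mul_zero])
  rw [← Finset.mem_antidiagonal.mp hx, map_add]
  exact Nat.add_le_add (hf _ h1) (hg _ h2)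

/-- Scaling by a constant. [cite: Lazard1955, §III] -/
theorem C_mul (hf : LowDeg N f) (c : ℤ) : LowDeg N (MvPolynomial.C c * f) := fun α hα => by
  rw [MvPolynomial.coeff_C_mul] at hα
  exact hf α (fun h => hα (by rw [h, mul_zero]))

/-- Monomials. [cite: Lazard1955, §III] -/
theorem monomial (α : ℕ →₀ ℕ) (c : ℤ) : LowDeg (Finsupp.degree α) (MvPolynomial.monomial α c) := fun β hβ => by
  classical
  rw [MvPolynomial.coeff_monomial] at hβ
  split_ifs at hβ with h
  · rw [h]
  · exact (hβ rfl).elim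

/-- Variables have degree `≥ 1`. [cite: Lazard1955, §III] -/
theorem X (i : ℕ) : LowDeg 1 (MvPolynomial.X i : MvPolynomial ℕ ℤ) := by
  have h := monomial (Finsupp.single i 1) 1
  rwa [Finsupp.degree_single] at h

/-- **Product rule for first-order congruences**: if `f ≡ f'` and `g ≡ g'` to one order higher than their own orders, so is
`fg ≡ f'g'`. [cite: Lazard1955, §III] -/
theorem mul_sub_mul {a b : ℕ} {f f' g g' : MvPolynomial ℕ ℤ} (hf : LowDeg a f)
    (hff' : LowDeg (a + 1) (f - f')) (hg' : LowDeg b g') (hgg' : LowDeg (b + 1) (g - g')) :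
    LowDeg (a + b + 1) (f * g - f' * g') := by
  have h : f * g - f' * g' = f * (g - g') + (f - f') * g' := by ring
  rw [h]
  refine LowDeg.add ?_ ?_
  · have := hf.mul hgg'; rwa [show a + (b + 1) = a + b + 1 by ring] at this
  · have := hff'.mul hg'; rwa [show a + 1 + b = a + b + 1 by ring] at this

/-- Powers of a first-order congruence. [cite: Lazard1955, §III] -/
theorem pow_sub_pow {u u' : MvPolynomial ℕ ℤ} (hu : LowDeg 1 u) (hu' : LowDeg 1 u') (huu' : LowDeg 2 (u - u')) (k : ℕ) :
    LowDeg k (u ^ k) ∧ LowDeg k (u' ^ k) ∧ LowDeg (k + 1) (u ^ k - u' ^ k) := by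
  induction k with
  | zero => exact ⟨zero_le _, zero_le _, by rw [pow_zero, pow_zero, sub_self]; exact zero 1⟩
  | succ k ih =>
    refine ⟨?_, ?_, ?_⟩
    · rw [pow_succ]; exact ih.1.mul hu
    · rw [pow_succ]; exact ih.2.1.mul hu'
    · rw [pow_succ, pow_succ]; exact mul_sub_mul ih.1 ih.2.2 hu' huu'

end LowDeg

/-- The scaling endomorphism `T_i ↦ c_i T_i` multiplies the coefficient of `T^α` by `Π c_i^{α_i}`. [cite: Lazard1955, §III] -/
theorem coeff_aeval_C_mul_X (c : ℕ → ℤ) (p : MvPolynomial ℕ ℤ) (α : ℕ →₀ ℕ) :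
    MvPolynomial.coeff α (MvPolynomial.aeval (fun i => MvPolynomial.C (c i) * MvPolynomial.X i) p) =
      (α.prod fun i k => c i ^ k) * MvPolynomial.coeff α p := by
  classical
  induction p using MvPolynomial.induction_on' with
  | monomial β a =>
    rw [MvPolynomial.aeval_monomial, MvPolynomial.coeff_monomial]
    have hprod : (β.prod fun i k => (MvPolynomial.C (c i) * MvPolynomial.X i : MvPolynomial ℕ ℤ) ^ k) =
        MvPolynomial.C (β.prod fun i k => c i ^ k) * MvPolynomial.monomial β 1 := by
      rw [MvPolynomial.monomial_eq, MvPolynomial.C_1, one_mul, Finsupp.prod, Finsupp.prod, Finsupp.prod, map_prod,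
        ← prod_mul_distrib]
      refine prod_congr rfl fun i _ => ?_
      rw [mul_pow, map_pow]
    rw [hprod, MvPolynomial.algebraMap_eq, ← mul_assoc, ← map_mul, MvPolynomial.coeff_C_mul, MvPolynomial.coeff_monomial]
    split_ifs with h
    · subst h; ring
    · simp
  | add p q hp hq => rw [map_add, MvPolynomial.coeff_add, MvPolynomial.coeff_add, hp, hq, mul_add]

/-- **Injectivity criterion («unitriangular» endomorphisms of `ℤ[T]`)**: a ring endomorphism `ψ` of `ℤ[T₀, T₁, …]` with
`ψ(T_i) ≡ c_i T_i` modulo monomials of degree `≥ 2`, all `c_i ≠ 0`, is injective (compare the monomials of lowest degree).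
[cite: Lazard1955, §III (p. 263)] -/
theorem injective_of_linearPart (ψ : MvPolynomial ℕ ℤ →+* MvPolynomial ℕ ℤ) (c : ℕ → ℤ) (hc : ∀ i, c i ≠ 0)
    (hψ : ∀ i, LowDeg 2 (ψ (MvPolynomial.X i) - MvPolynomial.C (c i) * MvPolynomial.X i)) :
    Function.Injective ψ := by
  classical
  set σ : MvPolynomial ℕ ℤ →+* MvPolynomial ℕ ℤ :=
    (MvPolynomial.aeval fun i => MvPolynomial.C (c i) * MvPolynomial.X i).toRingHom with hσ
  have hσX : ∀ i, σ (MvPolynomial.X i) = MvPolynomial.C (c i) * MvPolynomial.X i := fun i => by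
    rw [hσ]; exact MvPolynomial.aeval_X _ i
  have hψC : ∀ a : ℤ, ψ (MvPolynomial.C a) = MvPolynomial.C a := fun a => by
    rw [eq_intCast MvPolynomial.C a, map_intCast]
  have hσC : ∀ a : ℤ, σ (MvPolynomial.C a) = MvPolynomial.C a := fun a => by
    rw [eq_intCast MvPolynomial.C a, map_intCast]
  -- (A) monomials: `ψ(T^α) ≡ σ(T^α)` to first order beyond `deg α`
  have hA : ∀ α : ℕ →₀ ℕ, LowDeg (Finsupp.degree α) (ψ (MvPolynomial.monomial α 1)) ∧
      LowDeg (Finsupp.degree α) (σ (MvPolynomial.monomial α 1)) ∧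
      LowDeg (Finsupp.degree α + 1) (ψ (MvPolynomial.monomial α 1) - σ (MvPolynomial.monomial α 1)) := by
    intro α
    induction α using Finsupp.induction with
    | zero =>
      rw [MvPolynomial.monomial_zero', MvPolynomial.C_1, map_one, map_one, sub_self, map_zero]
      exact ⟨LowDeg.zero_le _, LowDeg.zero_le _, LowDeg.zero _⟩
    | single_add i k α' _ _ ih =>
      rw [MvPolynomial.monomial_single_add, map_mul, map_mul, map_pow, map_pow, map_add, Finsupp.degree_single, hσX]
      have hu' : LowDeg 1 (MvPolynomial.C (c i) * MvPolynomial.X i) := (LowDeg.X i).C_mul _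
      have hu : LowDeg 1 (ψ (MvPolynomial.X i)) := by
        have h := ((hψ i).mono one_le_two).add hu'
        rwa [sub_add_cancel] at h
      obtain ⟨hk1, hk2, hk3⟩ := LowDeg.pow_sub_pow hu hu' (hψ i) k
      exact ⟨hk1.mul ih.1, hk2.mul ih.2.1, LowDeg.mul_sub_mul hk1 hk3 ih.2.1 ih.2.2⟩
  -- (B) any `p` with monomials of degree `≥ n`: `ψ p − σ p` has monomials of degree `≥ n + 1`
  have hB : ∀ (n : ℕ) (p : MvPolynomial ℕ ℤ), LowDeg n p → LowDeg (n + 1) (ψ p - σ p) := by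
    intro n p hp
    rw [MvPolynomial.as_sum p, map_sum, map_sum, ← sum_sub_distrib]
    refine LowDeg.sum _ fun α hα => ?_
    have hdeg : n ≤ Finsupp.degree α := hp α (MvPolynomial.mem_support_iff.mp hα)
    have hmon : MvPolynomial.monomial α (MvPolynomial.coeff α p) =
        MvPolynomial.C (MvPolynomial.coeff α p) * MvPolynomial.monomial α 1 := by
      rw [MvPolynomial.C_mul_monomial, mul_one]
    rw [hmon, map_mul, map_mul, hψC, hσC, ← mul_sub]
    exact ((hA α).2.2.C_mul _).mono (by omega)
  -- injectivity: look at a monomial of lowest degree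
  refine (injective_iff_map_eq_zero ψ).mpr fun p hp => ?_
  by_contra hne
  obtain ⟨α₀, hα₀, hmin⟩ := exists_min_image p.support Finsupp.degree (MvPolynomial.support_nonempty.mpr hne)
  have hlow : LowDeg (Finsupp.degree α₀) p := fun α hα => hmin α (MvPolynomial.mem_support_iff.mpr hα)
  have hr := hB _ p hlow
  have hcoeffσ : MvPolynomial.coeff α₀ (σ p) = (α₀.prod fun i k => c i ^ k) * MvPolynomial.coeff α₀ p :=
    coeff_aeval_C_mul_X c p α₀
  have hzero : MvPolynomial.coeff α₀ (ψ p - σ p) = 0 := by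
    by_contra h
    have := hr α₀ h
    omega
  rw [hp, zero_sub, MvPolynomial.coeff_neg, neg_eq_zero, hcoeffσ] at hzero
  rcases mul_eq_zero.mp hzero with h | h
  · rw [Finsupp.prod, prod_eq_zero_iff] at h
    obtain ⟨i, _, hi⟩ := h
    exact hc i (pow_eq_zero_iff'.mp hi).1
  · exact (MvPolynomial.mem_support_iff.mp hα₀) h

namespace LazardRing

/-! ## §2 Lazard's theorem -/

/-- **`Φ ∘ θ : ℤ[T] → ℤ[b]` is injective** (`T_k ↦ Φ(t_{k+2}) ≡ −ν(k+2) b_k` to first order). [cite: Lazard1955, §III (p. 263)] -/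
theorem phiHom_comp_genHom_injective : Function.Injective (phiHom.comp genHom) := by
  refine injective_of_linearPart _ (fun i => -(lazardNu (i + 2) : ℤ))
    (fun i => neg_ne_zero.mpr (by exact_mod_cast (lazardNu_pos (i + 2)).ne')) fun i => ?_
  intro α hα
  by_contra hlt
  apply hα
  rw [RingHom.comp_apply, genHom_X, MvPolynomial.coeff_sub, MvPolynomial.coeff_C_mul, MvPolynomial.coeff_X]
  -- `deg α ≤ 1`: `α = 0` or `α = single k 1`
  have hdeg : Finsupp.degree α ≤ 1 := by omega
  by_cases h0 : α = 0
  · subst h0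
    rw [coeff_zero_phiHom_tGen (by omega), if_neg (Finsupp.single_ne_zero.mpr one_ne_zero)]; ring
  · obtain ⟨k, hk⟩ : ∃ k, α = Finsupp.single k 1 := by
      have hpos : 0 < Finsupp.degree α := by
        rw [pos_iff_ne_zero]; exact fun h => h0 ((Finsupp.degree_eq_zero_iff α).mp h)
      obtain ⟨k, hk⟩ := Finsupp.support_nonempty_iff.mpr h0
      refine ⟨k, ?_⟩
      have hk1 : α k ≤ Finsupp.degree α := by
        rw [Finsupp.degree_apply]; exact single_le_sum (fun _ _ => Nat.zero_le _) hk
      have hαk : α k = 1 := by have := Finsupp.mem_support_iff.mp hk; omega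
      ext j
      by_cases hj : j = k
      · subst hj; simp [hαk]
      · rw [Finsupp.single_apply, if_neg (Ne.symm hj)]
        by_contra hne
        have hj' : j ∈ α.support := Finsupp.mem_support_iff.mpr hne
        have h2 : α k + α j ≤ Finsupp.degree α := by
          rw [Finsupp.degree_apply]; exact add_le_sum (fun _ _ => Nat.zero_le _) hk hj' (Ne.symm hj)
        have : 0 < α j := Nat.pos_of_ne_zero hne
        omega
    subst hk
    rw [coeff_single_phiHom_tGen (by omega) k]
    by_cases hik : i = k
    · subst hik; simp
    · rw [if_neg (by omega), if_neg (fun h => hik ((Finsupp.single_left_injective one_ne_zero) h))]; ring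

/-- **`θ : ℤ[T] → L` is injective.** [cite: Lazard1955, Théorème II] -/
theorem genHom_injective : Function.Injective genHom :=
  Function.Injective.of_comp (f := phiHom) (by exact phiHom_comp_genHom_injective)

/-- **LAZARD'S THEOREM**: the Lazard ring is the polynomial ring `ℤ[T₀, T₁, …]` on one generator in each weight
`k + 1 ≥ 1` (`T_k ↦ t_{k+2}`). [cite: Lazard1955, Théorème II] -/
def equivMvPolynomial : MvPolynomial ℕ ℤ ≃+* LazardRing :=
  RingEquiv.ofBijective genHom ⟨genHom_injective, genHom_surjective⟩

/-- The isomorphism is `θ`. [cite: Lazard1955, Théorème II] -/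
@[simp] theorem equivMvPolynomial_apply (p : MvPolynomial ℕ ℤ) : equivMvPolynomial p = genHom p := rfl

/-- **The Lazard ring is an integral domain** (being a polynomial ring over `ℤ`). [cite: Lazard1955, Théorème II] -/
theorem isDomain : IsDomain LazardRing :=
  MulEquiv.isDomain (MvPolynomial ℕ ℤ) equivMvPolynomial.symm.toMulEquiv

/-! ## §3 The universal law over `ℤ[T]` -/

/-- **The universal commutative one-dimensional formal group law over the polynomial ring `ℤ[T₀, T₁, …]`** (Lazard's
universal law, transported along `L ≅ ℤ[T]`). [cite: Lazard1955, Théorème II] -/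
def univLawPoly : FormalGroup (MvPolynomial ℕ ℤ) := univLaw.map equivMvPolynomial.symm.toRingHom

/-- The universal law over `ℤ[T]` is commutative. [cite: Lazard1955, Théorème II] -/
theorem univLawPoly_isComm : univLawPoly.IsComm := by
  haveI := univLaw_isComm
  refine ⟨MvPowerSeries.ext fun d => ?_⟩
  change coeff d (MvPowerSeries.map _ univLaw.toPowerSeries) =
    coeff d (MvPowerSeries.subst _ (MvPowerSeries.map _ univLaw.toPowerSeries))
  rw [coeff_subst_swap, MvPowerSeries.coeff_map, MvPowerSeries.coeff_map, coeff_swapIdx_formalGroup]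

/-- Base change is functorial on laws (plumbing): `(F.map f).map g = F.map (g ∘ f)`. [cite: Hazewinkel1978, §1.1 (1.1.6)] -/
theorem map_map {R S T : Type*} [CommRing R] [CommRing S] [CommRing T] (F : FormalGroup R) (f : R →+* S) (g : S →+* T) :
    (F.map f).map g = F.map (g.comp f) :=
  FormalGroup.ext (MvPowerSeries.map_map f g F.toPowerSeries)


/-- The composite `L ≅ ℤ[T] → L` is the identity on the universal law (plumbing). [cite: Lazard1955, Théorème II] -/
theorem map_univLawPoly_equiv : univLawPoly.map equivMvPolynomial.toRingHom = univLaw := by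
  rw [univLawPoly, map_map, RingEquiv.toRingHom_comp_symm_toRingHom]
  exact FormalGroup.ext (by rw [FormalGroup.map_toPowerSeries, MvPowerSeries.map_id]; rfl)

/-- **UNIVERSALITY over `ℤ[T]` (existence): every commutative one-dimensional formal group law over any commutative ring is a
base change of the universal law over the polynomial ring `ℤ[T₀, T₁, …]`.** [cite: Lazard1955, Théorème II] -/
theorem exists_map_univLawPoly_eq {B : Type u} [CommRing B] (G : FormalGroup B) [G.IsComm] :
    ∃ f : MvPolynomial ℕ ℤ →+* B, univLawPoly.map f = G :=
  ⟨(lift G).comp equivMvPolynomial.toRingHom, by rw [← map_map, map_univLawPoly_equiv, map_univLaw_lift]⟩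

/-- **UNIVERSALITY over `ℤ[T]` (uniqueness): the classifying map is unique.** [cite: Lazard1955, Théorème II] -/
theorem map_univLawPoly_ext {B : Type u} [CommRing B] {f g : MvPolynomial ℕ ℤ →+* B}
    (h : univLawPoly.map f = univLawPoly.map g) : f = g := by
  have h' : univLaw.map (f.comp equivMvPolynomial.symm.toRingHom) = univLaw.map (g.comp equivMvPolynomial.symm.toRingHom) := by
    rw [← map_map, ← map_map]; exact h
  have := hom_ext h'
  have hcomp := congrArg (fun φ : LazardRing →+* B => φ.comp equivMvPolynomial.toRingHom) this
  simpa [RingHom.comp_assoc] using hcomp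

end LazardRing

end Literature.RingTheory.FormalGroups
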